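import Literature.NumberTheory.LFunctions.WeilCombZeroSide
import Literature.NumberTheory.LFunctions.DivisorCombFactorisationComplex
import HarnessLib

/-!
# The zero side of the explicit formula for `ζ`-mollified combs of a complex resonator

Topic `Literature/NumberTheory/LFunctions`. The complex-resonator version of
`Literature/NumberTheory/LFunctions/WeilCombZeroSide.lean`. For a finitely supported complex
resonator `α : ℕ → ℂ` (`α_ℓ = 0` for `ℓ > L`), a Weil test function `b₁`, a length `M` and a
width parameter `1 ≤ κ ≤ M`, the `ζ`-mollified comb is
`g(u) = ∑_{m ≤ LM} a_m b₁((u - log m) M/κ)`, `a_m = ∑_{k ∣ m, k ≤ M} α(m/k)/√k`, with transform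
`ĝ(s) = (κ/M) b̂₁(1/2 + (s-1/2)κ/M) Ã(s) ζ_M(1-s)`, `|Ã(s)| ≤ C_α = ∑ ‖α_ℓ‖ √ℓ` for `Re s ≤ 1`
(`Literature/NumberTheory/LFunctions/DivisorCombFactorisationComplex.lean`).  The zero sum is
bounded ABSOLUTELY, so the real-resonator argument applies verbatim:

* `Literature.NumberTheory.LFunctions.norm_weilMellin_comb_quadratic_le_complex` — the pointwise
  bound `‖(g ⋆ g̃)^(ρ)‖ ≤ (κ/M)² C_α² w(ρ) ‖ζ_M(ρ)‖ ‖ζ_M(1-ρ)‖`;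
* `Literature.NumberTheory.LFunctions.exists_norm_weilZeroSidePartial_comb_le_complex` — every
  truncated zero side of `g ⋆ g̃` is bounded by
  `C C_α² (κ/M)² (‖b₁‖₁'² M + ‖b₁^{(n)}‖₁'² κ^{-2n} (1 + log M)³ M)` (`n ≥ 3`), uniformly in the
  truncation height (the weights `w(ρ)` are those of the real case:
  `comb_weight_le_weilL1_sq`, `comb_weight_le_of_height`).

## References

* E. Bombieri, *Remarks on Weil's quadratic functional in the theory of prime numbers I* (2000), §3.
* E. C. Titchmarsh, *The Theory of the Riemann Zeta-Function*, 2nd ed. (1986), Theorem 4.11.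
-/

noncomputable section

open Complex Set Filter Finset
open scoped Real Topology ComplexConjugate

namespace Literature.NumberTheory.LFunctions

/-- The complex mollified coefficient at `m = 0` vanishes (`divisors 0 = ∅`). [folklore] -/
theorem divisorConv_zero_complex (α : ℕ → ℂ) (M : ℕ) :
    (∑ k ∈ (Nat.divisors 0).filter (· ≤ M), α (0 / k) / (Real.sqrt k : ℂ)) = 0 := by
  simp

/-- **Pointwise bound at a zero for the `ζ`-mollified comb of a complex resonator.** For
`1 ≤ κ ≤ M` and a non-trivial zero `ρ`, with `g(u) = ∑_{m ≤ LM} a_m b₁((u - log m) M/κ)` and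
`λ = M/κ`:
`‖(g ⋆ g̃)^(ρ)‖ ≤ (κ/M)² C_α² (‖b̂₁(1/2 + (ρ-1/2)/λ)‖ ‖b̂₁(1/2 + (1/2-ρ̄)/λ)‖)`
`· ‖ζ_M(ρ)‖ ‖ζ_M(1-ρ)‖`, `C_α = ∑_{ℓ ≤ L} ‖α_ℓ‖ √ℓ`. [cite: Bombieri2000, §3] -/
theorem norm_weilMellin_comb_quadratic_le_complex {α : ℕ → ℂ} {L : ℕ}
    (hα : ∀ m, L < m → α m = 0) {b₁ : ℝ → ℂ} (hb : IsWeilTest b₁) {M : ℕ} {κ : ℝ} (hκ1 : 1 ≤ κ)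
    (hκM : κ ≤ M) {ρ : ℂ} (hρ : ρ ∈ ZetaZeros.riemannZetaNontrivialZeros) :
    ‖weilMellin (weilConv
        (fun u ↦ ∑ m ∈ Finset.range (L * M + 1),
          (∑ k ∈ (Nat.divisors m).filter (· ≤ M), α (m / k) / (Real.sqrt k : ℂ)) *
            b₁ ((u - Real.log m) * ((M : ℝ) / κ)))
        (weilReflect (fun u ↦ ∑ m ∈ Finset.range (L * M + 1),
          (∑ k ∈ (Nat.divisors m).filter (· ≤ M), α (m / k) / (Real.sqrt k : ℂ)) *
            b₁ ((u - Real.log m) * ((M : ℝ) / κ))))) ρ‖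
      ≤ (κ / M) ^ 2 * (∑ ℓ ∈ Finset.Icc 1 L, ‖α ℓ‖ * Real.sqrt ℓ) ^ 2 *
        (‖weilMellin b₁ (1 / 2 + (ρ - 1 / 2) / (((M : ℝ) / κ : ℝ) : ℂ))‖ *
          ‖weilMellin b₁ (1 / 2 + (1 / 2 - conj ρ) / (((M : ℝ) / κ : ℝ) : ℂ))‖) *
        (‖∑ k ∈ Finset.Icc 1 M, (k : ℂ) ^ (-ρ)‖ * ‖∑ k ∈ Finset.Icc 1 M, (k : ℂ) ^ (-(1 - ρ))‖) := by
  have hM0 : (0 : ℝ) < M := by linarith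
  have hκ0 : 0 < κ := by linarith
  set lam : ℝ := (M : ℝ) / κ with hlam
  have hlam0 : 0 < lam := div_pos hM0 hκ0
  set c : ℕ → ℂ := fun m ↦ ∑ k ∈ (Nat.divisors m).filter (· ≤ M), α (m / k) / (Real.sqrt k : ℂ)
    with hc
  have hc0 : c 0 = 0 := by simp [hc]
  set g : ℝ → ℂ := fun u ↦ ∑ m ∈ Finset.range (L * M + 1), c m * b₁ ((u - Real.log m) * lam)
    with hg
  have hgt : IsWeilTest g := isWeilTest_logComb hb c _ hlam0.ne'
  change ‖weilMellin (weilConv g (weilReflect g)) ρ‖ ≤ _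
  rw [weilMellin_weilQuadratic hgt, norm_mul, Complex.norm_conj]
  -- the two transforms
  have h1 := norm_weilMellin_logComb_le hb hc0 (L * M + 1) hlam0 ρ
  have h2 := norm_weilMellin_logComb_le hb hc0 (L * M + 1) hlam0 (1 - conj ρ)
  have hre1 : ρ.re ≤ 1 := (ZetaZeros.riemannZetaNontrivialZeros.re_lt_one hρ).le
  have hre2 : (1 - conj ρ).re ≤ 1 := by
    simp only [sub_re, one_re, conj_re]
    linarith [ZetaZeros.riemannZetaNontrivialZeros.re_pos hρ]
  have hA1 := norm_sum_divisorConv_mul_cpow_le_complex hα M hre1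
  have hA2 := norm_sum_divisorConv_mul_cpow_le_complex hα M hre2
  have hconj : ‖∑ k ∈ Finset.Icc 1 M, (k : ℂ) ^ (-(1 - (1 - conj ρ)))‖
      = ‖∑ k ∈ Finset.Icc 1 M, (k : ℂ) ^ (-ρ)‖ := by
    rw [show (1 : ℂ) - (1 - conj ρ) = conj ρ by ring, sum_Icc_cpow_neg_conj, Complex.norm_conj]
  rw [hconj] at hA2
  have harg : (1 : ℂ) - conj ρ - 1 / 2 = 1 / 2 - conj ρ := by ring
  rw [harg] at h2 hA2
  have hlaminv : lam⁻¹ = κ / M := by rw [hlam, inv_div]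
  rw [hlaminv] at h1 h2
  set Cα : ℝ := ∑ ℓ ∈ Finset.Icc 1 L, ‖α ℓ‖ * Real.sqrt ℓ with hCα
  have hCα0 : 0 ≤ Cα := Finset.sum_nonneg fun ℓ _ ↦ by positivity
  set B1 : ℝ := ‖weilMellin b₁ (1 / 2 + (ρ - 1 / 2) / lam)‖ with hB1
  set B2 : ℝ := ‖weilMellin b₁ (1 / 2 + (1 / 2 - conj ρ) / lam)‖ with hB2
  set Z1 : ℝ := ‖∑ k ∈ Finset.Icc 1 M, (k : ℂ) ^ (-ρ)‖ with hZ1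
  set Z2 : ℝ := ‖∑ k ∈ Finset.Icc 1 M, (k : ℂ) ^ (-(1 - ρ))‖ with hZ2
  have hg1 : ‖weilMellin g ρ‖ ≤ κ / M * B1 * (Cα * Z2) :=
    h1.trans (mul_le_mul_of_nonneg_left hA1 (by positivity))
  have hg2 : ‖weilMellin g (1 - conj ρ)‖ ≤ κ / M * B2 * (Cα * Z1) :=
    h2.trans (mul_le_mul_of_nonneg_left hA2 (by positivity))
  have hfin : ‖weilMellin g ρ‖ * ‖weilMellin g (1 - conj ρ)‖
      ≤ (κ / M * B1 * (Cα * Z2)) * (κ / M * B2 * (Cα * Z1)) :=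
    mul_le_mul hg1 hg2 (norm_nonneg _) (by positivity)
  refine hfin.trans (le_of_eq ?_)
  ring

/-- **The zero side of the explicit formula for `ζ`-mollified combs of a complex resonator.**
There is an absolute constant `C` such that for every complex resonator `α : ℕ → ℂ` supported on
`[1, L]`, every Weil test function `b₁`, every `n ≥ 3`, and all `M`, `κ` with `1 ≤ κ ≤ M`, the
comb `g(u) = ∑_{m ≤ LM} (∑_{k ∣ m, k ≤ M} α(m/k)/√k) b₁((u - log m) M/κ)` satisfies, for every
truncation height `T`,
`‖∑_{|Im ρ| ≤ T} m(ρ) (g ⋆ g̃)^(ρ)‖`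
`≤ C (∑_{ℓ≤L} ‖α_ℓ‖√ℓ)² (κ/M)² ((∫‖b₁‖e^{|t|/2})² M + (∫‖b₁^{(n)}‖e^{|t|/2})² κ^{-2n} (1 + log M)³ M)`.
[cite: Bombieri2000, §3] -/
theorem exists_norm_weilZeroSidePartial_comb_le_complex :
    ∃ C : ℝ, 0 < C ∧ ∀ (α : ℕ → ℂ) (L : ℕ), (∀ m, L < m → α m = 0) →
      ∀ (b₁ : ℝ → ℂ), IsWeilTest b₁ → ∀ (n : ℕ), 3 ≤ n →
      ∀ (M : ℕ) (κ : ℝ), 1 ≤ κ → κ ≤ M →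
        let g : ℝ → ℂ := fun u ↦ ∑ m ∈ Finset.range (L * M + 1),
          (∑ k ∈ (Nat.divisors m).filter (· ≤ M), α (m / k) / (Real.sqrt k : ℂ)) *
            b₁ ((u - Real.log m) * ((M : ℝ) / κ))
        ∀ T : ℝ, ‖weilZeroSidePartial (weilConv g (weilReflect g)) T‖
          ≤ C * (∑ ℓ ∈ Finset.Icc 1 L, ‖α ℓ‖ * Real.sqrt ℓ) ^ 2 * (κ / M) ^ 2 *
            (weilL1 b₁ ^ 2 * M
              + weilL1 (deriv^[n] b₁) ^ 2 / κ ^ (2 * n) * (1 + Real.log M) ^ 3 * M) := by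
  obtain ⟨C, hC, htot⟩ := exists_sum_weighted_norm_zetaPartialSum_mul_le
  refine ⟨C, hC, ?_⟩
  intro α L hα b₁ hb n hn M κ hκ1 hκM g T
  have hM1 : 1 ≤ M := by
    have : (1 : ℝ) ≤ M := hκ1.trans hκM
    exact_mod_cast this
  have hM0 : (0 : ℝ) < M := by exact_mod_cast hM1
  have hκ0 : 0 < κ := by linarith
  set lam : ℝ := (M : ℝ) / κ with hlam
  set Cα : ℝ := ∑ ℓ ∈ Finset.Icc 1 L, ‖α ℓ‖ * Real.sqrt ℓ with hCα
  have hCα0 : 0 ≤ Cα := Finset.sum_nonneg fun ℓ _ ↦ by positivity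
  -- the weight and its two bounds
  set w : ZetaZeros.riemannZetaNontrivialZeros → ℝ := fun ρ ↦
    ‖weilMellin b₁ (1 / 2 + ((ρ : ℂ) - 1 / 2) / (lam : ℂ))‖ *
      ‖weilMellin b₁ (1 / 2 + (1 / 2 - conj (ρ : ℂ)) / (lam : ℂ))‖ with hw
  have hw0 : ∀ ρ, 0 ≤ w ρ := fun ρ ↦ by positivity
  have hwlow : ∀ ρ : ZetaZeros.riemannZetaNontrivialZeros, |(ρ : ℂ).im| ≤ M →
      w ρ ≤ weilL1 b₁ ^ 2 := fun ρ _ ↦ comb_weight_le_weilL1_sq hb hκ1 hκM ρ.2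
  have hwhigh : ∀ (j : ℕ) (ρ : ZetaZeros.riemannZetaNontrivialZeros),
      (2 : ℝ) ^ j * M < |(ρ : ℂ).im| → |(ρ : ℂ).im| ≤ (2 : ℝ) ^ (j + 1) * M →
      w ρ ≤ weilL1 (deriv^[n] b₁) ^ 2 / κ ^ (2 * n) / 64 ^ j :=
    fun j ρ hj _ ↦ comb_weight_le_of_height hb hn hκ1 hκM ρ.2 hj
  have hsum := htot M hM1 (weilL1 b₁ ^ 2) (weilL1 (deriv^[n] b₁) ^ 2 / κ ^ (2 * n))
    (by positivity) (by positivity) w hw0 hwlow hwhigh (weilZeroFinset T)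
  -- pointwise
  have hpt : ∀ ρ ∈ weilZeroFinset T,
      ‖(riemannZetaZeroOrder (ρ : ℂ) : ℂ) * weilMellin (weilConv g (weilReflect g)) ρ‖
        ≤ (κ / M) ^ 2 * Cα ^ 2 * ((riemannZetaZeroOrder (ρ : ℂ) : ℝ) * (w ρ *
          (‖∑ k ∈ Finset.Icc 1 M, (k : ℂ) ^ (-(ρ : ℂ))‖ *
            ‖∑ k ∈ Finset.Icc 1 M, (k : ℂ) ^ (-(1 - (ρ : ℂ)))‖))) := by
    intro ρ _
    have hm : (0 : ℝ) ≤ riemannZetaZeroOrder (ρ : ℂ) := by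
      exact_mod_cast zero_le_one.trans (ZetaZeros.riemannZetaNontrivialZeros.one_le_order ρ.2)
    have hnm : ‖(riemannZetaZeroOrder (ρ : ℂ) : ℂ)‖ = (riemannZetaZeroOrder (ρ : ℂ) : ℝ) := by
      rw [Complex.norm_intCast, abs_of_nonneg hm]
    rw [norm_mul, hnm]
    have h := norm_weilMellin_comb_quadratic_le_complex hα hb hκ1 hκM ρ.2
    have h' := mul_le_mul_of_nonneg_left h hm
    refine h'.trans (le_of_eq ?_)
    simp only [hw, hCα, hlam]
    ring
  calc ‖weilZeroSidePartial (weilConv g (weilReflect g)) T‖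
      = ‖∑ ρ ∈ weilZeroFinset T,
          (riemannZetaZeroOrder (ρ : ℂ) : ℂ) * weilMellin (weilConv g (weilReflect g)) ρ‖ := by
        rw [weilZeroSidePartial_eq_sum]
    _ ≤ ∑ ρ ∈ weilZeroFinset T,
          ‖(riemannZetaZeroOrder (ρ : ℂ) : ℂ) * weilMellin (weilConv g (weilReflect g)) ρ‖ :=
        norm_sum_le _ _
    _ ≤ ∑ ρ ∈ weilZeroFinset T, (κ / M) ^ 2 * Cα ^ 2 * ((riemannZetaZeroOrder (ρ : ℂ) : ℝ) * (w ρ *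
          (‖∑ k ∈ Finset.Icc 1 M, (k : ℂ) ^ (-(ρ : ℂ))‖ *
            ‖∑ k ∈ Finset.Icc 1 M, (k : ℂ) ^ (-(1 - (ρ : ℂ)))‖))) := Finset.sum_le_sum hpt
    _ = (κ / M) ^ 2 * Cα ^ 2 * ∑ ρ ∈ weilZeroFinset T, (riemannZetaZeroOrder (ρ : ℂ) : ℝ) * (w ρ *
          (‖∑ k ∈ Finset.Icc 1 M, (k : ℂ) ^ (-(ρ : ℂ))‖ *
            ‖∑ k ∈ Finset.Icc 1 M, (k : ℂ) ^ (-(1 - (ρ : ℂ)))‖)) := by rw [Finset.mul_sum]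
    _ ≤ (κ / M) ^ 2 * Cα ^ 2 * (C * (weilL1 b₁ ^ 2 * M
          + weilL1 (deriv^[n] b₁) ^ 2 / κ ^ (2 * n) * (1 + Real.log M) ^ 3 * M)) :=
        mul_le_mul_of_nonneg_left hsum (by positivity)
    _ = C * Cα ^ 2 * (κ / M) ^ 2 * (weilL1 b₁ ^ 2 * M
          + weilL1 (deriv^[n] b₁) ^ 2 / κ ^ (2 * n) * (1 + Real.log M) ^ 3 * M) := by ring

end Literature.NumberTheory.LFunctions
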